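import Summits.ValiantsHypothesis.ValiantsHypothesis.Theorems.LacunarySymmetroidMatrixDescartesDoorA26WallBubblingTwoScaleMonotone

/-!
# Wall bubbling for `DoorA26` — (W-split) rung 2: SLOT SPLITTING FOR THE DOUBLETON CLASSES across two scales

HONEST FRAMING.  Chain lemma for obligation (W) `stub_weylFaces` of `Cruxes/DoorA26/Lines/wall_bubbling.lean` (stmt-ValiantsHypothesis-19979
`DoorA26`; OPEN, typed, never asserted), W2 seat val-sym-door-p1 g14; named residual «(W-split) multi-scale linking» (line lead's rev 4, register
R2761).  Second rung of (W-split) in the kernel: the DOUBLETON part of the slot-splitting rule `hsplit` of the count `…WallBubblingChainCeiling.chain_ceiling`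
(p663233), in the two-scale currency of `…WallBubblingTwoScaleMonotone` (same letters at log-distance `L → ∞`, confluent frames linked by the
transvected rescaling `A ↦ A + Λ'B`, `Λ' = dslope (y ↦ e^{yL}) 0 w`).

At a generic Weyl face (positions `0, 5` merging, `δ0 5 = δ0 0`) the doubleton value `α + δ_k` (`k ∉ {0,5}`) has the two frame slots
`(0,k)` (degree 0: `polar(U₀+U₅, U_k)`) and `(5,k)` (degree 1, the confluent `t`-slot: `polar(wU₅, U_k)`).

* `eventually_dslope_exp_gt` — the transvection coefficient outgrows every `a·e^{wL} + b`: `|Λ'| > a e^{wL} + b` eventually (`w → 0`, `L → +∞`;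
  four regimes `±w`, `|w|L ≶ 1`, using only `x + 1 ≤ eˣ`);
* **`twoScale_doubleton_split`** — under the hypotheses of `twoScale_monotone` (Gram-normalised frames converging at both scales with dominated
  entries): the `t`-slot of a doubleton class is alive in AT MOST ONE of the two cluster limits — `Γ 5 k ≠ 0 → Γ' 5 k ≠ 0 → False`.
  Mechanism: aliveness at the first scale forces `G_{0k} ≈ −G_{5k}`, at the second `G_{0k} ≈ −e^{wL}G_{5k}`, i.e. `|Λ'| ≤ 1/κ + e^{wL}/κ'` — impossible.

With `twoScale_monotone` (`hmono`) this types the doubleton half of `hsplit`; the TRIPLE class (degrees `0,1,2`, splitting `(2,0),(1,1),(0,2)` over two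
clusters, none over three) is the remaining un-typed input of the count — and the count caps at 20 regardless (`chain_ceiling_attained_two_clusters`):
(W-split) proper is a statement about pencils.  No new definitions; nothing here bears on `DoorA26`, `MatrixDescartes` (stmt-ValiantsHypothesis-18050)
or `VP ≠ VNP`.

[folklore] elementary exponential inequalities; [this work] the two-scale doubleton bookkeeping.
-/

-- `Summit.ValiantsHypothesis.ValiantsHypothesis.…` repeats a component by the D-0017 layout
-- (single-conjunct summit), which the `dupNamespace` linter flags; the name is mandated.
set_option linter.dupNamespace false

namespace Summit.ValiantsHypothesis.ValiantsHypothesis.Theorems.LacunarySymmetroidMatrixDescartes.WallBubbling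

open Finset Filter Topology
open Bubbling (polar polar_apply polar_comm polar_smul_left_right)
open scoped BigOperators

/-! ## 1. The transvection coefficient outgrows `a e^{wL} + b` -/

/-- Lower bounds for the divided difference `dslope (y ↦ e^{yL}) 0 w`: `≥ L` for `w ≥ 0`, `≥ (e^{wL} − 1)/w` exactly for `w ≠ 0`;
packaged as the four-regime estimate used below. [folklore] -/
theorem dslope_exp_lower (L w : ℝ) :
    (0 ≤ w → L ≤ dslope (fun y : ℝ => Real.exp (y * L)) 0 w) ∧
    (0 < w → (Real.exp (w * L) - 1) / w = dslope (fun y : ℝ => Real.exp (y * L)) 0 w) ∧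
    (w < 0 → (1 - Real.exp (w * L)) / (-w) = dslope (fun y : ℝ => Real.exp (y * L)) 0 w) := by
  have hid : ∀ {w : ℝ}, w ≠ 0 → dslope (fun y : ℝ => Real.exp (y * L)) 0 w = (Real.exp (w * L) - 1) / w := by
    intro w hw
    have h := sub_mul_dslope_exp 0 w L
    rw [zero_mul, Real.exp_zero, sub_zero] at h
    rw [eq_div_iff hw, mul_comm]
    exact h
  refine ⟨fun hw => ?_, fun hw => (hid hw.ne').symm, fun hw => ?_⟩
  · rcases hw.lt_or_eq with hw | hw
    · rw [hid hw.ne', le_div_iff₀ hw]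
      have := Real.add_one_le_exp (w * L)
      linarith
    · rw [← hw, dslope_exp_same, zero_mul, Real.exp_zero, mul_one]
  · rw [hid hw.ne]
    rw [div_neg, ← neg_div, neg_sub]

/-- **The transvection coefficient outgrows `a·e^{wL} + b`**: for `w_ν → 0`, `L_ν → +∞` and `a, b ≥ 0`, eventually
`a e^{w_ν L_ν} + b < |dslope (y ↦ e^{yL_ν}) 0 w_ν|`. [folklore] -/
theorem eventually_dslope_exp_gt (w L : ℕ → ℝ) (hw : Tendsto w atTop (𝓝 0)) (hL : Tendsto L atTop atTop) (a b : ℝ) (ha : 0 ≤ a) (hb : 0 ≤ b) :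
    ∀ᶠ ν in atTop, a * Real.exp (w ν * L ν) + b < |dslope (fun y : ℝ => Real.exp (y * L ν)) 0 (w ν)| := by
  have e2 : (2 : ℝ) ≤ Real.exp 1 := by have := Real.add_one_le_exp (1 : ℝ); linarith
  -- eventually `|w| ≤ 1/(4(a+b+1))` and `L ≥ 4(a e + b) + 4(a+b+1)`
  have hw' : ∀ᶠ ν in atTop, |w ν| ≤ 1 / (4 * (a + b + 1)) := by
    have : Tendsto (fun ν => |w ν|) atTop (𝓝 0) := by simpa using hw.abs
    exact (this.eventually (Iic_mem_nhds (by positivity))).mono fun ν h => h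
  have hL' : ∀ᶠ ν in atTop, 4 * (a * Real.exp 1 + b) + 4 * (a + b + 1) ≤ L ν := hL.eventually_ge_atTop _
  filter_upwards [hw', hL'] with ν hwν hLν
  have hL0 : 0 ≤ L ν := le_trans (by positivity) hLν
  obtain ⟨hge, hpos, hneg⟩ := dslope_exp_lower (L ν) (w ν)
  have hae : 0 ≤ a * Real.exp 1 := by positivity
  have hab1 : 0 < a + b + 1 := by positivity
  rcases lt_trichotomy (w ν) 0 with hwn | hw0 | hwp
  · -- `w < 0`: `e^{wL} ≤ 1`, and `Λ' = (1 − e^{−|w|L})/|w|`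
    have hexp1 : Real.exp (w ν * L ν) ≤ 1 := Real.exp_le_one_iff.mpr (mul_nonpos_of_nonpos_of_nonneg hwn.le hL0)
    rw [← hneg hwn]
    have hwpos : 0 < -w ν := neg_pos.mpr hwn
    rw [abs_of_nonneg (div_nonneg (by linarith) hwpos.le), lt_div_iff₀ hwpos]
    by_cases hv : (-w ν) * L ν ≤ 1
    · -- `1 − e^{wL} ≥ |w|L/2`
      have h1 : (-w ν) * L ν / 2 ≤ 1 - Real.exp (w ν * L ν) := by
        -- `e^{wL} ≤ 1/(1 + |w|L)` from `1 + |w|L ≤ e^{|w|L}`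
        have hx : 1 + (-w ν) * L ν ≤ Real.exp ((-w ν) * L ν) := by have := Real.add_one_le_exp ((-w ν) * L ν); linarith
        have hpos1 : 0 < 1 + (-w ν) * L ν := by nlinarith
        have : Real.exp (w ν * L ν) * (1 + (-w ν) * L ν) ≤ 1 := by
          calc Real.exp (w ν * L ν) * (1 + (-w ν) * L ν) ≤ Real.exp (w ν * L ν) * Real.exp ((-w ν) * L ν) :=
                mul_le_mul_of_nonneg_left hx (Real.exp_pos _).le
            _ = 1 := by rw [← Real.exp_add]; simp
        nlinarith [Real.exp_pos (w ν * L ν)]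
      have h2 : (a * Real.exp (w ν * L ν) + b) * -w ν ≤ (a + b) * -w ν :=
        mul_le_mul_of_nonneg_right (by nlinarith) hwpos.le
      have h3 : (a + b) * -w ν ≤ (a + b) * (1 / (4 * (a + b + 1))) := by
        have : -w ν ≤ 1 / (4 * (a + b + 1)) := by rw [← abs_of_neg hwn]; exact hwν
        exact mul_le_mul_of_nonneg_left this (by positivity)
      have h4 : (a + b) * (1 / (4 * (a + b + 1))) < 1 / 4 := by
        rw [← mul_div_assoc, mul_one, div_lt_div_iff₀ (by positivity) (by norm_num)]
        nlinarith
      have h6 : (a + b) * -w ν < (-w ν) * L ν / 2 := by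
        have := mul_pos hwpos (show (0 : ℝ) < L ν / 2 - (a + b) by linarith [hae])
        nlinarith
      linarith
    · push Not at hv
      have h1 : 1 / 2 ≤ 1 - Real.exp (w ν * L ν) := by
        have : Real.exp (w ν * L ν) ≤ Real.exp (-1) := Real.exp_le_exp.mpr (by nlinarith)
        have he : Real.exp (-1) ≤ 1 / 2 := by
          rw [Real.exp_neg, inv_eq_one_div, div_le_div_iff₀ (Real.exp_pos 1) (by norm_num)]
          linarith
        linarith
      have h2 : (a * Real.exp (w ν * L ν) + b) * -w ν ≤ (a + b) * (1 / (4 * (a + b + 1))) := by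
        have : -w ν ≤ 1 / (4 * (a + b + 1)) := by rw [← abs_of_neg hwn]; exact hwν
        calc (a * Real.exp (w ν * L ν) + b) * -w ν ≤ (a + b) * -w ν := mul_le_mul_of_nonneg_right (by nlinarith) hwpos.le
          _ ≤ (a + b) * (1 / (4 * (a + b + 1))) := mul_le_mul_of_nonneg_left this (by positivity)
      have h4 : (a + b) * (1 / (4 * (a + b + 1))) < 1 / 4 := by
        rw [← mul_div_assoc, mul_one, div_lt_div_iff₀ (by positivity) (by norm_num)]
        nlinarith
      linarith
  · -- `w = 0`: `Λ' = L`
    have h := hge hw0.symm.le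
    rw [hw0] at h ⊢
    rw [zero_mul, Real.exp_zero, mul_one]
    have : a + b < L ν := by nlinarith [Real.exp_pos (1 : ℝ)]
    exact lt_of_lt_of_le this (le_trans h (le_abs_self _))
  · -- `w > 0`
    rw [← hpos hwp, abs_of_nonneg (div_nonneg (by linarith [Real.one_le_exp (mul_nonneg hwp.le hL0)]) hwp.le), lt_div_iff₀ hwp]
    by_cases hv : w ν * L ν ≤ 1
    · -- `e^{wL} ≤ e`, `Λ' ≥ L`
      have hexpe : Real.exp (w ν * L ν) ≤ Real.exp 1 := Real.exp_le_exp.mpr hv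
      have h1 : w ν * L ν ≤ Real.exp (w ν * L ν) - 1 := by have := Real.add_one_le_exp (w ν * L ν); linarith
      have h2 : (a * Real.exp (w ν * L ν) + b) * w ν ≤ (a * Real.exp 1 + b) * w ν :=
        mul_le_mul_of_nonneg_right (by nlinarith) hwp.le
      have h3 : (a * Real.exp 1 + b) * w ν < w ν * L ν := by
        have := mul_pos hwp (show (0 : ℝ) < L ν - (a * Real.exp 1 + b) by linarith [hae])
        nlinarith
      linarith
    · push Not at hv
      -- `e^{wL} − 1 ≥ e^{wL}/2` and `1/(2w) > a + b`
      have hbig : 2 ≤ Real.exp (w ν * L ν) := le_trans e2 (Real.exp_le_exp.mpr hv.le)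
      have hwle : w ν ≤ 1 / (4 * (a + b + 1)) := by rw [← abs_of_pos hwp]; exact hwν
      have h1 : (a * Real.exp (w ν * L ν) + b) * w ν ≤ (a + b) * Real.exp (w ν * L ν) * w ν := by
        have : a * Real.exp (w ν * L ν) + b ≤ (a + b) * Real.exp (w ν * L ν) := by nlinarith
        exact mul_le_mul_of_nonneg_right this hwp.le
      have h2 : (a + b) * Real.exp (w ν * L ν) * w ν ≤ (a + b) * Real.exp (w ν * L ν) * (1 / (4 * (a + b + 1))) :=
        mul_le_mul_of_nonneg_left hwle (by positivity)
      have h3 : (a + b) * Real.exp (w ν * L ν) * (1 / (4 * (a + b + 1))) < Real.exp (w ν * L ν) / 4 := by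
        rw [← mul_div_assoc, mul_one, div_lt_div_iff₀ (by positivity) (by norm_num)]
        nlinarith [Real.exp_pos (w ν * L ν)]
      linarith

/-! ## 2. Slot splitting for a doubleton class across two scales -/

/-- **SLOT SPLITTING FOR DOUBLETONS (two scales).**  Same letters `U^ν` at two clusters at log-distance `L_ν → +∞` (hypotheses as in
`twoScale_monotone`); `k ∉ {0, 5}`.  The confluent `t`-slot `(5,k)` of the doubleton value `α + δ_k` cannot be alive in BOTH Gram-normalised limits.
[this work] -/
theorem twoScale_doubleton_split (δs : ℕ → Fin 6 → ℝ) (δ0 : Fin 6 → ℝ)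
    (hδ : ∀ l, Tendsto (fun ν => δs ν l) atTop (𝓝 (δ0 l))) (h05 : δ0 5 = δ0 0)
    (U : ℕ → Fin 6 → Matrix (Fin 2) (Fin 2) ℝ) (L : ℕ → ℝ) (hL : Tendsto L atTop atTop)
    (μ μ' : ℕ → ℝ) (hμ : ∀ ν, 0 < μ ν) (hμ' : ∀ ν, 0 < μ' ν)
    (hdom : ∀ ν a b, |polar (if a = 0 then U ν 0 + U ν 5 else if a = 5 then (δs ν 5 - δs ν 0) • U ν 5 else U ν a)
      (if b = 0 then U ν 0 + U ν 5 else if b = 5 then (δs ν 5 - δs ν 0) • U ν 5 else U ν b)| ≤ μ ν)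
    (hdom' : ∀ ν a b, |polar
      (if a = 0 then Real.exp (δs ν 0 * L ν) • U ν 0 + Real.exp (δs ν 5 * L ν) • U ν 5
        else if a = 5 then (δs ν 5 - δs ν 0) • (Real.exp (δs ν 5 * L ν) • U ν 5) else Real.exp (δs ν a * L ν) • U ν a)
      (if b = 0 then Real.exp (δs ν 0 * L ν) • U ν 0 + Real.exp (δs ν 5 * L ν) • U ν 5
        else if b = 5 then (δs ν 5 - δs ν 0) • (Real.exp (δs ν 5 * L ν) • U ν 5) else Real.exp (δs ν b * L ν) • U ν b)| ≤ μ' ν)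
    (Γ Γ' : Fin 6 → Fin 6 → ℝ)
    (hΓ : ∀ a b, Tendsto (fun ν => polar (if a = 0 then U ν 0 + U ν 5 else if a = 5 then (δs ν 5 - δs ν 0) • U ν 5 else U ν a)
      (if b = 0 then U ν 0 + U ν 5 else if b = 5 then (δs ν 5 - δs ν 0) • U ν 5 else U ν b) / μ ν) atTop (𝓝 (Γ a b)))
    (hΓ' : ∀ a b, Tendsto (fun ν => polar
      (if a = 0 then Real.exp (δs ν 0 * L ν) • U ν 0 + Real.exp (δs ν 5 * L ν) • U ν 5
        else if a = 5 then (δs ν 5 - δs ν 0) • (Real.exp (δs ν 5 * L ν) • U ν 5) else Real.exp (δs ν a * L ν) • U ν a)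
      (if b = 0 then Real.exp (δs ν 0 * L ν) • U ν 0 + Real.exp (δs ν 5 * L ν) • U ν 5
        else if b = 5 then (δs ν 5 - δs ν 0) • (Real.exp (δs ν 5 * L ν) • U ν 5) else Real.exp (δs ν b * L ν) • U ν b) / μ' ν)
      atTop (𝓝 (Γ' a b)))
    (k : Fin 6) (hk0 : k ≠ 0) (hk5 : k ≠ 5) (h1 : Γ 5 k ≠ 0) (h2 : Γ' 5 k ≠ 0) : False := by
  set w : ℕ → ℝ := fun ν => δs ν 5 - δs ν 0 with hw
  set κ : ℝ := |Γ 5 k| / 2 with hκ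
  set κ' : ℝ := |Γ' 5 k| / 2 with hκ'
  have hκpos : 0 < κ := by rw [hκ]; exact half_pos (abs_pos.mpr h1)
  have hκ'pos : 0 < κ' := by rw [hκ']; exact half_pos (abs_pos.mpr h2)
  have h50 : ((5 : Fin 6) = 0) = False := by simp
  -- eventual aliveness
  have e1 : ∀ᶠ ν in atTop, κ * μ ν ≤ |polar ((δs ν 5 - δs ν 0) • U ν 5) (U ν k)| := by
    have h := ((hΓ 5 k).abs).eventually_const_lt (show κ < |Γ 5 k| by rw [hκ]; linarith [abs_pos.mpr h1])
    filter_upwards [h] with ν hν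
    simp only [h50, hk0, hk5, if_false, if_true] at hν
    rw [abs_div, abs_of_pos (hμ ν), lt_div_iff₀ (hμ ν)] at hν
    exact hν.le
  have e2 : ∀ᶠ ν in atTop, κ' * μ' ν ≤ |polar ((δs ν 5 - δs ν 0) • (Real.exp (δs ν 5 * L ν) • U ν 5)) (Real.exp (δs ν k * L ν) • U ν k)| := by
    have h := ((hΓ' 5 k).abs).eventually_const_lt (show κ' < |Γ' 5 k| by rw [hκ']; linarith [abs_pos.mpr h2])
    filter_upwards [h] with ν hν
    simp only [h50, hk0, hk5, if_false, if_true] at hν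
    rw [abs_div, abs_of_pos (hμ' ν), lt_div_iff₀ (hμ' ν)] at hν
    exact hν.le
  have hw0 : Tendsto w atTop (𝓝 0) := by
    have := (hδ 5).sub (hδ 0)
    rw [h05, sub_self] at this
    exact this
  have e3 := eventually_dslope_exp_gt w L hw0 hL (1 / κ') (1 / κ) (by positivity) (by positivity)
  have hfalse : ∀ᶠ ν : ℕ in atTop, False := by
    filter_upwards [e1, e2, e3] with ν hν1 hν2 hν3
    -- the two frame entries of the doubleton at the first scale
    set gB : ℝ := polar ((δs ν 5 - δs ν 0) • U ν 5) (U ν k) with hgB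
    set gA : ℝ := polar (U ν 0 + U ν 5) (U ν k) with hgA
    set Λ : ℝ := dslope (fun y : ℝ => Real.exp (y * L ν)) 0 (δs ν 5 - δs ν 0) with hΛ
    have hgAle : |gA| ≤ μ ν := by
      have := hdom ν 0 k
      simp only [hk0, hk5, if_false, if_true] at this
      exact this
    -- the same entries at the second scale, via `frame_shift`
    have hB' : polar ((δs ν 5 - δs ν 0) • (Real.exp (δs ν 5 * L ν) • U ν 5)) (Real.exp (δs ν k * L ν) • U ν k)
        = Real.exp (δs ν 5 * L ν) * Real.exp (δs ν k * L ν) * gB := by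
      rw [smul_comm, polar_smul_left_right]
    have hA' : polar (Real.exp (δs ν 0 * L ν) • U ν 0 + Real.exp (δs ν 5 * L ν) • U ν 5) (Real.exp (δs ν k * L ν) • U ν k)
        = Real.exp (δs ν 0 * L ν) * Real.exp (δs ν k * L ν) * (gA + Λ * gB) := by
      have hs := frame_shift (δs ν) (U ν) (L ν) 0
      have h05' : ((0 : Fin 6) = 5) = False := by simp
      simp only [h05', if_true, if_false] at hs
      rw [hs, show Real.exp (δs ν k * L ν) • U ν k = Real.exp (δs ν k * L ν) • (U ν k + (0 : ℝ) • ((δs ν 5 - δs ν 0) • U ν 5)) by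
        rw [zero_smul, add_zero], polar_shift_expand]
      rw [hgA, hgB, hΛ]
      ring
    have hA'le : |polar (Real.exp (δs ν 0 * L ν) • U ν 0 + Real.exp (δs ν 5 * L ν) • U ν 5) (Real.exp (δs ν k * L ν) • U ν k)| ≤ μ' ν := by
      have := hdom' ν 0 k
      simp only [hk0, hk5, if_false, if_true] at this
      exact this
    -- `κ' μ' ≤ |gB'| = e^{(δ5+δk)L}|gB|` and `e^{(δ0+δk)L}|gA + Λ gB| ≤ μ'`
    rw [hB'] at hν2
    rw [hA'] at hA'le
    have hgBpos : 0 < |gB| := lt_of_lt_of_le (mul_pos hκpos (hμ ν)) hν1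
    -- |Λ| |gB| ≤ |gA| + e^{wL} |gB| / κ'
    have hE0 : 0 < Real.exp (δs ν 0 * L ν) * Real.exp (δs ν k * L ν) := mul_pos (Real.exp_pos _) (Real.exp_pos _)
    have hkey1 : |gA + Λ * gB| ≤ Real.exp (w ν * L ν) * |gB| / κ' := by
      -- from hA'le and hν2
      rw [abs_mul, abs_of_pos hE0] at hA'le
      rw [abs_mul, abs_of_pos (mul_pos (Real.exp_pos _) (Real.exp_pos _))] at hν2
      have hμ'le : μ' ν ≤ Real.exp (δs ν 5 * L ν) * Real.exp (δs ν k * L ν) * |gB| / κ' := by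
        rw [le_div_iff₀ hκ'pos]; linarith
      have : Real.exp (δs ν 0 * L ν) * Real.exp (δs ν k * L ν) * |gA + Λ * gB|
          ≤ Real.exp (δs ν 0 * L ν) * Real.exp (δs ν k * L ν) * (Real.exp (w ν * L ν) * |gB| / κ') := by
        calc _ ≤ μ' ν := hA'le
          _ ≤ Real.exp (δs ν 5 * L ν) * Real.exp (δs ν k * L ν) * |gB| / κ' := hμ'le
          _ = Real.exp (δs ν 0 * L ν) * Real.exp (δs ν k * L ν) * (Real.exp (w ν * L ν) * |gB| / κ') := by
              rw [hw]
              simp only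
              rw [show δs ν 5 * L ν = δs ν 0 * L ν + (δs ν 5 - δs ν 0) * L ν by ring, Real.exp_add]
              ring
      exact le_of_mul_le_mul_left this hE0
    have hkey2 : |Λ| * |gB| ≤ |gA| + Real.exp (w ν * L ν) * |gB| / κ' := by
      have t : |Λ * gB| ≤ |gA + Λ * gB| + |gA| := by
        have := abs_sub_le (Λ * gB) (gA + Λ * gB) 0
        have h' : |Λ * gB - (gA + Λ * gB)| = |gA| := by rw [show Λ * gB - (gA + Λ * gB) = -gA by ring, abs_neg]
        have := abs_add_le (gA + Λ * gB) (-gA)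
        rw [show gA + Λ * gB + -gA = Λ * gB by ring, abs_neg] at this
        linarith
      rw [← abs_mul]
      linarith
    -- divide by |gB| and use |gA| ≤ μ ≤ |gB|/κ
    have hkey3 : |Λ| ≤ 1 / κ' * Real.exp (w ν * L ν) + 1 / κ := by
      have hμle : μ ν ≤ |gB| / κ := by rw [le_div_iff₀ hκpos]; linarith
      have : |Λ| * |gB| ≤ (1 / κ' * Real.exp (w ν * L ν) + 1 / κ) * |gB| := by
        calc |Λ| * |gB| ≤ |gA| + Real.exp (w ν * L ν) * |gB| / κ' := hkey2
          _ ≤ |gB| / κ + Real.exp (w ν * L ν) * |gB| / κ' := by linarith [le_trans hgAle hμle]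
          _ = (1 / κ' * Real.exp (w ν * L ν) + 1 / κ) * |gB| := by ring
      exact le_of_mul_le_mul_right this hgBpos
    exact absurd (lt_of_le_of_lt hkey3 hν3) (lt_irrefl _)
  exact hfalse.exists.elim fun _ h => h

end Summit.ValiantsHypothesis.ValiantsHypothesis.Theorems.LacunarySymmetroidMatrixDescartes.WallBubbling
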